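import Summits.QuantumFields.YangMills.Theorems.UnitScaleTiltProp7HfRealityTrace
import Summits.QuantumFields.YangMills.Theorems.UnitScaleTiltProp7SectET3SymmetryRowsT3
import HarnessLib

/-!
# Route `UnitScaleTilt`, crux «MinimiserStabilityRegPr» (stmt-QuantumFields-19200, stub EX) ∕ (O″χ) B0 (stmt-QuantumFields-20520), node N06(d = 3), route (α) —
# LAYER 0, ROWS OF BRICK L0b PART 3 (def-free): **THE THREE REALITY ROWS OF PRINT'S `Δ₁ = Pᵀ(Δ^η + T_J)P` ([Balaban1985BackgroundPropagators] (3.127)–(3.128)) AT THE SLOT — σ-ROW, TRACELESS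
# SECTOR, SYMMETRY — REDUCED TO THE SAME THREE ROWS OF THE J-TERM `T_J`**, hence the EX knit's `hH₁R` clause for `H₁f … (DeltaOne … T_J) U₀` (★w4-20520 g4's ✓`H1f_isHermitian_traceless_at_regPr`
# at the `Δ₁` slot) modulo `T_J`'s three rows, and UNCONDITIONALLY at `T_J := 0` (today's instantiation, ✓`DeltaOne_zero`: `Δ₁ = Δ_π`) for `U₀ ∈ 𝔘_k(ε₀)` in the two windows of record

Cell `ym-inputs` (desk `pub/ym-inputs`, INPUT-LIST.md v10 §4 row p01; ★w4-20520 g4 CONSUMER LINE 2026-08-28T11:53:15Z «for the knit's `H₁f L i U₀ := H1f … Δx U₀` at print's `Δ₁` slot … `hH₁R :=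
H1f_isHermitian_traceless_at_regPr Δ₁slot … hΔx hΔtr hΔsymm` with the THREE Δ₁ rows — p01 g2's layer»).  THEOREMS ONLY (0 `def`, 0 `sorry`); `--supports stmt-QuantumFields-20520 --as helper`;
count-neutral.  YM₃ on T³ is ladder rung R3, NOT the Clay problem; nothing here is a claim about a stub, a crux, d = 4 or the mass gap.

THE MATHEMATICS.  `Δ₁(U₀) = P†(Δ^η(U₀) + T_J(U₀))P` with `P = 1 − DG′R_SD*` (✓`DeltaOne`).  For an additive involution triple `(σ_E, σ_S, σ_F)` on (vector fields, gauge parameters, block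
fields), jointly anti-unitary (the conjugation `X ↦ Xᴴ`, fibrewise) or jointly unitary (the reflection of the traceless sector), commuting with real scalars and with the data `D_{U₀}`, `Q(U₀)`:
`P` commutes (★w4's ✓`gaugeCorr_comm`), `P†` commutes (✓`adjoint_comm_of_kind`), `Δ^η` commutes (p01 ✓`DeltaEta_toL2_star` ∕ ✓p629707 `trace_DeltaEta_toL2_eq_zero` + ✓`DeltaEta_isSymmetric`), so
`Δ₁` commutes as soon as `T_J` does (§1 `DeltaOne_comm`).  At the conjugation triple of ✓`Prop7SectET3HilbertLettersReality` this is the σ-row `hΔx` of the `Δ₁` slot (§2); at the reflection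
triple of ✓`Prop7H46RealityTrace` it is the traceless-sector row `hΔtr` (§3; the complement sector of `T_J` comes from its symmetry, as for `Δ^η`); `hΔsymm` is ✓`DeltaOne_isSymmetric`.  §4 plugs the
three into ★w4's ✓`H1f_isHermitian_traceless_at_regPr` (the `QTwS` rows BY NAME from ★w5's ✓`Prop7QTwSRealityOfRegPr`).

WHAT IS PROVED (member `F`, `h : n ≤ K`, weights `c₀ cB`, `a`; slot `TJ`; background `U₀`): §1 ★`DeltaOne_comm` (generic triple, hypotheses of ✓`DeltaPi_comm` + `hT`); §2 ★★`DeltaOne_toL2_star_of_rows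
(hQ) (hT)` (the `hΔx` shape at `Δx := DeltaOne … TJ`), `DeltaOne_toL2_star_of_regPr (hreg) (hT)`; §3 ★★`trace_DeltaOne_toL2_eq_zero_of_rows (hQtr) (hQsc) (hTtr) (hTsymm)` (the `hΔtr` shape),
`trace_DeltaOne_toL2_eq_zero_of_regPr (hreg) (hTtr) (hTsymm)`; §4 ★★★`H1f_isHermitian_traceless_at_regPr_DeltaOne (TJ) (hreg) (hT) (hTtr) (hTsymm)` — the knit's `hH₁R` clause at the `Δ₁` slot
modulo `T_J`'s σ-row, traceless row and symmetry — and ★★★`H1f_isHermitian_traceless_at_regPr_DeltaOne_zero (hreg)` — UNCONDITIONAL at `T_J := 0` (= the `Δ_π` slot by ✓`DeltaOne_zero`).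
NOT HERE: the three rows of the J-term OF RECORD `TJSlot` (brick L0b part 4 ✓∕⧗ `…DeltaOneT3JTerm`): they are calculus facts about `actionGrad`, `avgHess` (Schwarz, σ-reality, centre-equivariance
of the averaging) — the next sibling.
HONEST SCOPE.  Finite-dimensional Hilbert-space bookkeeping over landed letters; no estimate; nothing of print asserted; N06 NOT discharged; no stub closed.

References: T. Bałaban, CMP **99** (1985) 389–434 [Balaban1985BackgroundPropagators] ((3.118)–(3.120) p.419, (3.127)–(3.129) p.421, p.393 «the operators … are real»); CMP **102** (1985) 277–309
[Balaban1985Variational] ((51) p.286, (103) p.293, (110) p.294).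
-/

set_option autoImplicit false

noncomputable section

open scoped InnerProductSpace ComplexConjugate Matrix.Norms.L2Operator BigOperators

namespace Summit.QuantumFields.YangMills.Theorems.Prop7SectET3DeltaOne

open Literature.MathematicalPhysics.QuantumFieldTheory.Balaban1983to89
open Literature.MathematicalPhysics.QuantumFieldTheory.Balaban1983to89.T3ContinuumYM3Torus
open T3SectALandauChart (eta eta_pos)
open T3PrintedRegularMinimiser (RegPr)
open B9SectCLatticeCarrier (Bond)
open B9Eq311L2Pairing (WL2)
open B11Eq103H1Complex (SiteL2K BondL2K)
open B11Eq115Space (JetSup)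
open Summit.QuantumFields.YangMills.Theorems.Prop7SectET3Transport (periodsT3 siteEquiv bondEquiv bgOfCfg)
open Summit.QuantumFields.YangMills.Theorems.Prop7SectET3HilbertLetters (W₂ frobEquiv toL2 toL2S toL2B QL2 DL2 DstarL2 QL2_toL2 inner_toL2 inner_toL2B adjoint_DL2 toL2_symm_apply)
open Summit.QuantumFields.YangMills.Theorems.Prop7SectET3CurvedPropagators (HT Hf H1f)
open Summit.QuantumFields.YangMills.Theorems.Prop7SectET3WilsonHessian (DeltaEta DeltaEta_isSymmetric DeltaEta_toL2_star)
open Summit.QuantumFields.YangMills.Theorems.Prop7SectET3DeltaPi (gaugeCorr DeltaPiSlot)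
open Summit.QuantumFields.YangMills.Theorems.Prop7SymAvgTwSym (QTwS QTwS_star_comm_of_regPr QTwS_scalar_of_regPr QTwS_traceless_of_regPr)
open Summit.QuantumFields.YangMills.Theorems.Prop7SectET3PropagatorsReality (adjoint_comm_of_kind gaugeCorr_comm map_zero_of_map_add)
open Summit.QuantumFields.YangMills.Theorems.Prop7SectET3HilbertLettersReality (toL2_star_star toL2_star_add toL2_star_smul_real inner_toL2_star toL2S_star_star toL2S_star_add
  toL2S_star_smul_real inner_toL2S_star toL2B_star_star toL2B_star_add toL2B_star_smul_real inner_toL2B_star DL2_star_comm QL2_star_comm_of trace_DL2_apply_eq_zero)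
open Summit.QuantumFields.YangMills.Theorems.Prop7H46RealityTrace (reflection_comm_of_mapsTo mapsTo_orthogonal_of_adjoint exists_smul_one_of_trace_orthogonal trace_conjTranspose_mul_smul_one
  trace_DstarL2_apply_eq_zero)
open Summit.QuantumFields.YangMills.Theorems.Prop7HfRealityTrace (H1f_isHermitian_traceless_at_regPr)
open Summit.QuantumFields.YangMills.Theorems.Prop7WilsonHessianSectorRows (trace_DeltaEta_toL2_eq_zero)

variable (F : T3Family) (n K : ℕ) (h : n ≤ K) (c₀ cB a : ℝ) [Fact (0 < c₀)] [Fact (0 < cB)]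
variable (TJ : GaugeField (F.P K) 0 (Matrix.specialUnitaryGroup (Fin 2) ℂ) → (BondL2K ℂ 3 (periodsT3 F K) c₀ W₂ →ₗ[ℂ] BondL2K ℂ 3 (periodsT3 F K) c₀ W₂))
variable (U₀ : GaugeField (F.P K) 0 (Matrix.specialUnitaryGroup (Fin 2) ℂ))

/-! ## §1 `Δ₁ = Pᵀ(Δ^η + T_J)P` commutes with every (anti-)unitary involution triple its data commute with -/

section Generic

variable (σE : BondL2K ℂ 3 (periodsT3 F K) c₀ W₂ → BondL2K ℂ 3 (periodsT3 F K) c₀ W₂)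
variable (σS : SiteL2K ℂ 3 (periodsT3 F K) c₀ W₂ → SiteL2K ℂ 3 (periodsT3 F K) c₀ W₂)
variable (σF : WL2 ℂ (fun _ : PBond (F.P n) 0 => cB) W₂ → WL2 ℂ (fun _ : PBond (F.P n) 0 => cB) W₂)

/-- ★ **`Δ₁ = Pᵀ(Δ^η + T_J)P` (3.128) IS REAL WHEN `Δ^η_{U₀}` AND `T_J(U₀)` ARE** (and the data `D`, `Q` are): `P` commutes by ★w4's ✓`gaugeCorr_comm`, `Pᵀ = P†` by ✓`adjoint_comm_of_kind`,
the middle factor by additivity of `σ_E`. [cite: Balaban1985BackgroundPropagators, (3.118)–(3.120) p.419, (3.127)–(3.128) p.421] -/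
theorem DeltaOne_comm
    (hkind : ((∀ x y : BondL2K ℂ 3 (periodsT3 F K) c₀ W₂, ⟪σE x, σE y⟫_ℂ = ⟪y, x⟫_ℂ) ∧ (∀ x y : SiteL2K ℂ 3 (periodsT3 F K) c₀ W₂, ⟪σS x, σS y⟫_ℂ = ⟪y, x⟫_ℂ) ∧
        (∀ x y : WL2 ℂ (fun _ : PBond (F.P n) 0 => cB) W₂, ⟪σF x, σF y⟫_ℂ = ⟪y, x⟫_ℂ)) ∨
      ((∀ x y : BondL2K ℂ 3 (periodsT3 F K) c₀ W₂, ⟪σE x, σE y⟫_ℂ = ⟪x, y⟫_ℂ) ∧ (∀ x y : SiteL2K ℂ 3 (periodsT3 F K) c₀ W₂, ⟪σS x, σS y⟫_ℂ = ⟪x, y⟫_ℂ) ∧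
        (∀ x y : WL2 ℂ (fun _ : PBond (F.P n) 0 => cB) W₂, ⟪σF x, σF y⟫_ℂ = ⟪x, y⟫_ℂ)))
    (hEadd : ∀ x y, σE (x + y) = σE x + σE y) (hSadd : ∀ x y, σS (x + y) = σS x + σS y) (hFadd : ∀ x y, σF (x + y) = σF x + σF y)
    (hE2 : ∀ x, σE (σE x) = x) (hS2 : ∀ s, σS (σS s) = s) (hF2 : ∀ y, σF (σF y) = y)
    (hSsmul : ∀ (r : ℝ) (s : SiteL2K ℂ 3 (periodsT3 F K) c₀ W₂), σS (((r : ℝ) : ℂ) • s) = ((r : ℝ) : ℂ) • σS s)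
    (hD : ∀ s, DL2 F n K c₀ U₀ (σS s) = σE (DL2 F n K c₀ U₀ s))
    (hQ : ∀ x, QL2 F n K h c₀ cB U₀ (σE x) = σF (QL2 F n K h c₀ cB U₀ x))
    (hΔη : ∀ x, DeltaEta F n K c₀ U₀ (σE x) = σE (DeltaEta F n K c₀ U₀ x))
    (hT : ∀ x, TJ U₀ (σE x) = σE (TJ U₀ x)) (x : BondL2K ℂ 3 (periodsT3 F K) c₀ W₂) :
    DeltaOne F n K h c₀ cB a TJ U₀ (σE x) = σE (DeltaOne F n K h c₀ cB a TJ U₀ x) := by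
  have hP := gaugeCorr_comm F n K h c₀ cB a U₀ σE σS σF hkind hEadd hSadd hFadd hE2 hS2 hF2 hSsmul hD hQ
  have hPa : ∀ y, LinearMap.adjoint (gaugeCorr F n K h c₀ cB a U₀) (σE y) = σE (LinearMap.adjoint (gaugeCorr F n K h c₀ cB a U₀) y) :=
    adjoint_comm_of_kind (gaugeCorr F n K h c₀ cB a U₀) σE σE (hkind.elim (fun hk => Or.inl ⟨hk.1, hk.1⟩) (fun hk => Or.inr ⟨hk.1, hk.1⟩)) hE2 hE2 hP
  rw [DeltaOne_apply, DeltaOne_apply, hP, hΔη, hT, ← hEadd, ← hPa]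

end Generic

/-! ## §2 The σ-row of the `Δ₁` slot (conjugation triple of ✓`Prop7SectET3HilbertLettersReality`) -/

/-- ★★ **THE `Δ₁`-SLOT σ-ROW `hΔx` FROM `T_J`'S σ-ROW**: `Δ₁(U₀)(σf) = σ(Δ₁(U₀)f)`, `σ = toL2 ∘ star ∘ toL2⁻¹`, given the `QTwS` star-row `hQ` and the J-term's σ-row `hT` (`Δ^η`'s is p01's ✓`DeltaEta_toL2_star`).
[cite: Balaban1985BackgroundPropagators, (3.127)–(3.128) p.421, p.393; Balaban1985Variational, (51) p.286] -/
theorem DeltaOne_toL2_star_of_rows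
    (hQ : ∀ A : PBond (F.P K) 0 → Matrix (Fin 2) (Fin 2) ℂ, QTwS F n K h U₀ (star A) = star (QTwS F n K h U₀ A))
    (hT : ∀ f : BondL2K ℂ 3 (periodsT3 F K) c₀ W₂, TJ U₀ (toL2 F K c₀ (star ((toL2 F K c₀).symm f))) = toL2 F K c₀ (star ((toL2 F K c₀).symm (TJ U₀ f)))) :
    ∀ f : BondL2K ℂ 3 (periodsT3 F K) c₀ W₂,
      DeltaOne F n K h c₀ cB a TJ U₀ (toL2 F K c₀ (star ((toL2 F K c₀).symm f))) = toL2 F K c₀ (star ((toL2 F K c₀).symm (DeltaOne F n K h c₀ cB a TJ U₀ f))) :=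
  DeltaOne_comm F n K h c₀ cB a TJ U₀ (fun f => toL2 F K c₀ (star ((toL2 F K c₀).symm f))) (fun g => toL2S F K c₀ (star ((toL2S F K c₀).symm g)))
    (fun y => toL2B F n cB (star ((toL2B F n cB).symm y))) (Or.inl ⟨inner_toL2_star, inner_toL2S_star, inner_toL2B_star⟩)
    toL2_star_add toL2S_star_add toL2B_star_add toL2_star_star toL2S_star_star toL2B_star_star toL2S_star_smul_real (DL2_star_comm U₀) (QL2_star_comm_of U₀ hQ)
    (fun f => by
      have key := DeltaEta_toL2_star (F := F) (n := n) (K := K) (c₀ := c₀) U₀ ((toL2 F K c₀).symm f)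
      rwa [LinearEquiv.apply_symm_apply] at key)
    hT

/-- **THE `Δ₁`-SLOT σ-ROW AT `U₀ ∈ 𝔘_k(ε₀)`** in the windows `10⁹L²e ≤ 1`, `10¹²L³ε₀ ≤ 1` (the `QTwS` star-row BY NAME, ★w5's ✓`QTwS_star_comm_of_regPr`), modulo `T_J`'s σ-row only.
[cite: Balaban1985BackgroundPropagators, (3.128) p.421; Balaban1985Variational, (51) p.286] -/
theorem DeltaOne_toL2_star_of_regPr [Fact (0 < (F.L : ℝ))] [Fact (0 < ((F.L : ℝ)⁻¹) ^ (K - n))]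
    {ε₀ e : ℝ} (hε₀ : 0 < ε₀) (he : 0 < e) (hWe : 10 ^ 9 * (F.L : ℝ) ^ 2 * e ≤ 1) (hWε : 10 ^ 12 * (F.L : ℝ) ^ 3 * ε₀ ≤ 1) (hreg : RegPr F n K ε₀ U₀)
    (hT : ∀ f : BondL2K ℂ 3 (periodsT3 F K) c₀ W₂, TJ U₀ (toL2 F K c₀ (star ((toL2 F K c₀).symm f))) = toL2 F K c₀ (star ((toL2 F K c₀).symm (TJ U₀ f)))) :
    ∀ f : BondL2K ℂ 3 (periodsT3 F K) c₀ W₂,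
      DeltaOne F n K h c₀ cB a TJ U₀ (toL2 F K c₀ (star ((toL2 F K c₀).symm f))) = toL2 F K c₀ (star ((toL2 F K c₀).symm (DeltaOne F n K h c₀ cB a TJ U₀ f))) :=
  DeltaOne_toL2_star_of_rows F n K h c₀ cB a TJ U₀ (QTwS_star_comm_of_regPr F h hε₀ he hWe hWε U₀ hreg) hT

/-! ## §3 The traceless-sector row of the `Δ₁` slot (reflection triple of ✓`Prop7H46RealityTrace`) -/

/-- ★★ **THE `Δ₁`-SLOT TRACELESS ROW `hΔtr` FROM `T_J`'S TRACELESS ROW AND SYMMETRY**: traceless `A` give traceless `toL2⁻¹(Δ₁(U₀)(toL2 A))`, given the `QTwS` sector rows `hQtr`∕`hQsc` and the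
J-term's traceless row `hTtr` + symmetry `hTsymm` (for the complement sector) — ✓`DeltaOne_comm` at the reflections of the traceless sectors; `Δ^η`'s sectors are ✓p629707 + ✓`DeltaEta_isSymmetric`,
`D`'s are p03's. [cite: Balaban1985BackgroundPropagators, (3.127)–(3.128) p.421, p.393; Balaban1985Variational, (51) p.286] -/
theorem trace_DeltaOne_toL2_eq_zero_of_rows
    (hQtr : ∀ A : PBond (F.P K) 0 → Matrix (Fin 2) (Fin 2) ℂ, (∀ b, (A b).trace = 0) → ∀ c, (QTwS F n K h U₀ A c).trace = 0)
    (hQsc : ∀ c : PBond (F.P K) 0 → ℂ, ∃ d : PBond (F.P n) 0 → ℂ, QTwS F n K h U₀ (fun b => c b • (1 : Matrix (Fin 2) (Fin 2) ℂ)) = fun c' => d c' • 1)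
    (hTtr : ∀ A : PBond (F.P K) 0 → Matrix (Fin 2) (Fin 2) ℂ, (∀ b, (A b).trace = 0) → ∀ b, ((toL2 F K c₀).symm (TJ U₀ (toL2 F K c₀ A)) b).trace = 0)
    (hTsymm : (TJ U₀).IsSymmetric) :
    ∀ A : PBond (F.P K) 0 → Matrix (Fin 2) (Fin 2) ℂ, (∀ b, (A b).trace = 0) → ∀ b, ((toL2 F K c₀).symm (DeltaOne F n K h c₀ cB a TJ U₀ (toL2 F K c₀ A)) b).trace = 0 := by
  intro A hA b
  -- the traceless sectors of the three carriers
  let VE : Submodule ℂ (BondL2K ℂ 3 (periodsT3 F K) c₀ W₂) :=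
    { carrier := {f | ∀ b, ((toL2 F K c₀).symm f b).trace = 0}
      add_mem' := fun {f g} hf hg b => by rw [map_add, Pi.add_apply, Matrix.trace_add, hf b, hg b, add_zero]
      zero_mem' := fun b => by rw [map_zero, Pi.zero_apply, Matrix.trace_zero]
      smul_mem' := fun r f hf b => by rw [map_smul, Pi.smul_apply, Matrix.trace_smul, hf b, smul_zero] }
  let VS : Submodule ℂ (SiteL2K ℂ 3 (periodsT3 F K) c₀ W₂) :=
    { carrier := {g | ∀ x, ((toL2S F K c₀).symm g x).trace = 0}
      add_mem' := fun {f g} hf hg x => by rw [map_add, Pi.add_apply, Matrix.trace_add, hf x, hg x, add_zero]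
      zero_mem' := fun x => by rw [map_zero, Pi.zero_apply, Matrix.trace_zero]
      smul_mem' := fun r f hf x => by rw [map_smul, Pi.smul_apply, Matrix.trace_smul, hf x, smul_zero] }
  let VF : Submodule ℂ (WL2 ℂ (fun _ : PBond (F.P n) 0 => cB) W₂) :=
    { carrier := {y | ∀ c, ((toL2B F n cB).symm y c).trace = 0}
      add_mem' := fun {f g} hf hg c => by rw [map_add, Pi.add_apply, Matrix.trace_add, hf c, hg c, add_zero]
      zero_mem' := fun c => by rw [map_zero, Pi.zero_apply, Matrix.trace_zero]
      smul_mem' := fun r f hf c => by rw [map_smul, Pi.smul_apply, Matrix.trace_smul, hf c, smul_zero] }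
  haveI : CompleteSpace VE := FiniteDimensional.complete ℂ VE
  haveI : CompleteSpace VS := FiniteDimensional.complete ℂ VS
  haveI : CompleteSpace VF := FiniteDimensional.complete ℂ VF
  -- membership through the route-carrier readings
  have memVE : ∀ A : PBond (F.P K) 0 → Matrix (Fin 2) (Fin 2) ℂ, toL2 F K c₀ A ∈ VE ↔ ∀ b, (A b).trace = 0 := fun A => by
    change (∀ b, ((toL2 F K c₀).symm (toL2 F K c₀ A) b).trace = 0) ↔ _
    rw [LinearEquiv.symm_apply_apply]
  have memVF : ∀ B : PBond (F.P n) 0 → Matrix (Fin 2) (Fin 2) ℂ, toL2B F n cB B ∈ VF ↔ ∀ c, (B c).trace = 0 := fun B => by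
    change (∀ c, ((toL2B F n cB).symm (toL2B F n cB B) c).trace = 0) ↔ _
    rw [LinearEquiv.symm_apply_apply]
  -- the complements: scalar-valued fields
  have scalar_mem_VFc : ∀ d : PBond (F.P n) 0 → ℂ, toL2B F n cB (fun c => d c • (1 : Matrix (Fin 2) (Fin 2) ℂ)) ∈ VFᗮ := by
    intro d
    rw [Submodule.mem_orthogonal]
    intro v hv
    obtain ⟨B, rfl⟩ : ∃ B, v = toL2B F n cB B := ⟨(toL2B F n cB).symm v, ((toL2B F n cB).apply_symm_apply v).symm⟩
    rw [inner_toL2B]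
    refine mul_eq_zero_of_right _ (Finset.sum_eq_zero fun c _ => trace_conjTranspose_mul_smul_one ((memVF B).1 hv c) (d c))
  have exists_scalar_of_mem_VEc : ∀ u ∈ VEᗮ, ∃ c : PBond (F.P K) 0 → ℂ, u = toL2 F K c₀ (fun b => c b • (1 : Matrix (Fin 2) (Fin 2) ℂ)) := by
    intro u hu
    obtain ⟨A, rfl⟩ : ∃ A, u = toL2 F K c₀ A := ⟨(toL2 F K c₀).symm u, ((toL2 F K c₀).apply_symm_apply u).symm⟩
    have hpt : ∀ b, ∃ c : ℂ, A b = c • (1 : Matrix (Fin 2) (Fin 2) ℂ) := by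
      intro b
      refine exists_smul_one_of_trace_orthogonal (A b) fun X hX => ?_
      have hmem : toL2 F K c₀ (Pi.single b X) ∈ VE := (memVE _).2 fun b' => by
        by_cases hb : b' = b
        · subst hb; rw [Pi.single_eq_same]; exact hX
        · rw [Pi.single_eq_of_ne hb, Matrix.trace_zero]
      have h0 := (Submodule.mem_orthogonal _ _).1 hu _ hmem
      rw [inner_toL2, Finset.sum_eq_single b (fun b' _ hb' => by rw [Pi.single_eq_of_ne hb', Matrix.conjTranspose_zero, Matrix.zero_mul, Matrix.trace_zero])
        (fun hb => (hb (Finset.mem_univ b)).elim), Pi.single_eq_same] at h0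
      have hc₀ : ((c₀ : ℝ) : ℂ) ≠ 0 := Complex.ofReal_ne_zero.2 (ne_of_gt (Fact.out : 0 < c₀))
      exact (mul_eq_zero.1 h0).resolve_left hc₀
    choose c hc using hpt
    exact ⟨c, congrArg _ (funext hc)⟩
  -- DATA ROWS in sector form
  have hD_V : ∀ g ∈ VS, DL2 F n K c₀ U₀ g ∈ VE := by
    intro g hg
    obtain ⟨l, rfl⟩ : ∃ l, g = toL2S F K c₀ l := ⟨(toL2S F K c₀).symm g, ((toL2S F K c₀).apply_symm_apply g).symm⟩
    have hl : ∀ x, (l x).trace = 0 := fun x => by have := hg x; rwa [LinearEquiv.symm_apply_apply] at this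
    exact fun b' => trace_DL2_apply_eq_zero U₀ l hl b'
  have hDstar_V : ∀ f ∈ VE, LinearMap.adjoint (DL2 F n K c₀ U₀) f ∈ VS := by
    intro f hf
    obtain ⟨A, rfl⟩ : ∃ A, f = toL2 F K c₀ A := ⟨(toL2 F K c₀).symm f, ((toL2 F K c₀).apply_symm_apply f).symm⟩
    rw [adjoint_DL2]
    exact fun x => trace_DstarL2_apply_eq_zero F n K c₀ U₀ A ((memVE A).1 hf) x
  have hD_Vc : ∀ u ∈ VSᗮ, DL2 F n K c₀ U₀ u ∈ VEᗮ := fun u hu => mapsTo_orthogonal_of_adjoint _ VS VE hDstar_V hu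
  have hQ_V : ∀ f ∈ VE, QL2 F n K h c₀ cB U₀ f ∈ VF := by
    intro f hf
    obtain ⟨A, rfl⟩ : ∃ A, f = toL2 F K c₀ A := ⟨(toL2 F K c₀).symm f, ((toL2 F K c₀).apply_symm_apply f).symm⟩
    rw [QL2_toL2]
    exact (memVF _).2 (hQtr A ((memVE A).1 hf))
  have hQ_Vc : ∀ u ∈ VEᗮ, QL2 F n K h c₀ cB U₀ u ∈ VFᗮ := by
    intro u hu
    obtain ⟨c, rfl⟩ := exists_scalar_of_mem_VEc u hu
    obtain ⟨d, hd⟩ := hQsc c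
    rw [QL2_toL2, hd]
    exact scalar_mem_VFc d
  have hΔ_V : ∀ f ∈ VE, (DeltaEta F n K c₀ U₀ : BondL2K ℂ 3 (periodsT3 F K) c₀ W₂ →ₗ[ℂ] BondL2K ℂ 3 (periodsT3 F K) c₀ W₂) f ∈ VE := by
    intro f hf
    obtain ⟨A, rfl⟩ : ∃ A, f = toL2 F K c₀ A := ⟨(toL2 F K c₀).symm f, ((toL2 F K c₀).apply_symm_apply f).symm⟩
    exact fun b' => trace_DeltaEta_toL2_eq_zero U₀ A ((memVE A).1 hf) b'
  have hΔ_Vc : ∀ u ∈ VEᗮ, (DeltaEta F n K c₀ U₀ : BondL2K ℂ 3 (periodsT3 F K) c₀ W₂ →ₗ[ℂ] BondL2K ℂ 3 (periodsT3 F K) c₀ W₂) u ∈ VEᗮ := fun u hu =>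
    mapsTo_orthogonal_of_adjoint _ VE VE (fun v hv => by rw [(DeltaEta_isSymmetric U₀).adjoint_eq]; exact hΔ_V v hv) hu
  have hT_V : ∀ f ∈ VE, TJ U₀ f ∈ VE := by
    intro f hf
    obtain ⟨A, rfl⟩ : ∃ A, f = toL2 F K c₀ A := ⟨(toL2 F K c₀).symm f, ((toL2 F K c₀).apply_symm_apply f).symm⟩
    exact fun b' => hTtr A ((memVE A).1 hf) b'
  have hT_Vc : ∀ u ∈ VEᗮ, TJ U₀ u ∈ VEᗮ := fun u hu =>
    mapsTo_orthogonal_of_adjoint _ VE VE (fun v hv => by rw [hTsymm.adjoint_eq]; exact hT_V v hv) hu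
  -- the reflections intertwined by the data
  have hD : ∀ s, DL2 F n K c₀ U₀ (VS.reflection s) = VE.reflection (DL2 F n K c₀ U₀ s) := reflection_comm_of_mapsTo VS VE _ hD_V hD_Vc
  have hQ : ∀ x, QL2 F n K h c₀ cB U₀ (VE.reflection x) = VF.reflection (QL2 F n K h c₀ cB U₀ x) := reflection_comm_of_mapsTo VE VF _ hQ_V hQ_Vc
  have hΔη : ∀ x, DeltaEta F n K c₀ U₀ (VE.reflection x) = VE.reflection (DeltaEta F n K c₀ U₀ x) := fun x => by
    have := reflection_comm_of_mapsTo VE VE _ hΔ_V hΔ_Vc x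
    simpa only [ContinuousLinearMap.coe_coe] using this
  have hT : ∀ x, TJ U₀ (VE.reflection x) = VE.reflection (TJ U₀ x) := reflection_comm_of_mapsTo VE VE _ hT_V hT_Vc
  -- §1 at the unitary (reflection) triple
  have key := DeltaOne_comm F n K h c₀ cB a TJ U₀ (fun x => VE.reflection x) (fun s => VS.reflection s) (fun y => VF.reflection y)
    (Or.inr ⟨fun x y => VE.reflection.inner_map_map x y, fun x y => VS.reflection.inner_map_map x y, fun x y => VF.reflection.inner_map_map x y⟩)
    (fun x y => map_add _ x y) (fun x y => map_add _ x y) (fun x y => map_add _ x y)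
    (fun x => VE.reflection_reflection x) (fun s => VS.reflection_reflection s) (fun y => VF.reflection_reflection y)
    (fun r s => map_smul _ _ s) hD hQ hΔη hT (toL2 F K c₀ A)
  -- traceless `A` is fixed by `ρ_{V_E}`; hence so is `Δ₁(toL2 A)`, i.e. it is traceless
  have hAmem : toL2 F K c₀ A ∈ VE := (memVE A).2 hA
  rw [Submodule.reflection_mem_subspace_eq_self hAmem] at key
  exact ((Submodule.reflection_eq_self_iff _).1 key.symm) b

/-- **THE `Δ₁`-SLOT TRACELESS ROW AT `U₀ ∈ 𝔘_k(ε₀)`** in the windows (the `QTwS` sector rows BY NAME, ★w5's ✓`QTwS_traceless_of_regPr`∕✓`QTwS_scalar_of_regPr`), modulo `T_J`'s traceless row and symmetry.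
[cite: Balaban1985BackgroundPropagators, (3.128) p.421; Balaban1985Variational, (51) p.286] -/
theorem trace_DeltaOne_toL2_eq_zero_of_regPr [Fact (0 < (F.L : ℝ))] [Fact (0 < ((F.L : ℝ)⁻¹) ^ (K - n))]
    {ε₀ e : ℝ} (hε₀ : 0 < ε₀) (he : 0 < e) (hWe : 10 ^ 9 * (F.L : ℝ) ^ 2 * e ≤ 1) (hWε : 10 ^ 12 * (F.L : ℝ) ^ 3 * ε₀ ≤ 1) (hreg : RegPr F n K ε₀ U₀)
    (hTtr : ∀ A : PBond (F.P K) 0 → Matrix (Fin 2) (Fin 2) ℂ, (∀ b, (A b).trace = 0) → ∀ b, ((toL2 F K c₀).symm (TJ U₀ (toL2 F K c₀ A)) b).trace = 0)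
    (hTsymm : (TJ U₀).IsSymmetric) :
    ∀ A : PBond (F.P K) 0 → Matrix (Fin 2) (Fin 2) ℂ, (∀ b, (A b).trace = 0) → ∀ b, ((toL2 F K c₀).symm (DeltaOne F n K h c₀ cB a TJ U₀ (toL2 F K c₀ A)) b).trace = 0 :=
  trace_DeltaOne_toL2_eq_zero_of_rows F n K h c₀ cB a TJ U₀ (QTwS_traceless_of_regPr F h hε₀ he hWe hWε U₀ hreg) (QTwS_scalar_of_regPr F h hε₀ hWε U₀ hreg) hTtr hTsymm

/-! ## §4 The knit's `hH₁R` clause at the `Δ₁` slot -/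

/-- ★★★ **`hH₁R` AT PRINT'S `Δ₁` SLOT, MODULO THE J-TERM'S THREE ROWS**: at `U₀ ∈ 𝔘_k(ε₀)` in the windows `10⁹L²e ≤ 1`, `10¹²L³ε₀ ≤ 1`, Hermitian traceless block data `B` give Hermitian
traceless `(H₁f … (DeltaOne … T_J) U₀ B)(x)` — ★w4's ✓`H1f_isHermitian_traceless_at_regPr` at `Δx := DeltaOne … T_J` with `hΔx`, `hΔtr`, `hΔsymm` from §2, §3 and ✓`DeltaOne_isSymmetric`; displayed: `T_J`'s
σ-row `hT`, traceless row `hTtr`, symmetry `hTsymm`. [cite: Balaban1985Variational, (103) p.293, (110) p.294, (51) p.286; Balaban1985BackgroundPropagators, (3.128)–(3.129) p.421] -/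
theorem H1f_isHermitian_traceless_at_regPr_DeltaOne [Fact (0 < (F.L : ℝ))] [Fact (0 < ((F.L : ℝ)⁻¹) ^ (K - n))]
    {ε₀ e : ℝ} (hε₀ : 0 < ε₀) (he : 0 < e) (hWe : 10 ^ 9 * (F.L : ℝ) ^ 2 * e ≤ 1) (hWε : 10 ^ 12 * (F.L : ℝ) ^ 3 * ε₀ ≤ 1) (hreg : RegPr F n K ε₀ U₀)
    (hT : ∀ f : BondL2K ℂ 3 (periodsT3 F K) c₀ W₂, TJ U₀ (toL2 F K c₀ (star ((toL2 F K c₀).symm f))) = toL2 F K c₀ (star ((toL2 F K c₀).symm (TJ U₀ f))))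
    (hTtr : ∀ A : PBond (F.P K) 0 → Matrix (Fin 2) (Fin 2) ℂ, (∀ b, (A b).trace = 0) → ∀ b, ((toL2 F K c₀).symm (TJ U₀ (toL2 F K c₀ A)) b).trace = 0)
    (hTsymm : (TJ U₀).IsSymmetric) :
    ∀ B : PBond (F.P n) 0 → Matrix (Fin 2) (Fin 2) ℂ, (∀ c, (B c).IsHermitian ∧ (B c).trace = 0) →
      ∀ x : Bond 3 (periodsT3 F K), (JetSup.equiv _ _ _ (H1f F n K h c₀ cB a (DeltaOne F n K h c₀ cB a TJ) U₀ B) x).IsHermitian ∧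
        (JetSup.equiv _ _ _ (H1f F n K h c₀ cB a (DeltaOne F n K h c₀ cB a TJ) U₀ B) x).trace = 0 :=
  H1f_isHermitian_traceless_at_regPr F n K h c₀ cB a (DeltaOne F n K h c₀ cB a TJ) hε₀ he hWe hWε U₀ hreg
    (DeltaOne_toL2_star_of_regPr F n K h c₀ cB a TJ U₀ hε₀ he hWe hWε hreg hT)
    (trace_DeltaOne_toL2_eq_zero_of_regPr F n K h c₀ cB a TJ U₀ hε₀ he hWe hWε hreg hTtr hTsymm) (DeltaOne_isSymmetric (TJ := TJ) hTsymm)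

/-- ★★★ **`hH₁R` AT TODAY'S INSTANTIATION `T_J := 0` (`Δ₁ = Δ_π`, ✓`DeltaOne_zero`) — UNCONDITIONAL** at `U₀ ∈ 𝔘_k(ε₀)` in the windows: the zero J-term's three rows are trivial.
[cite: Balaban1985Variational, (103) p.293, (51) p.286; Balaban1985BackgroundPropagators, (3.119) p.419, (3.129) p.421] -/
theorem H1f_isHermitian_traceless_at_regPr_DeltaOne_zero [Fact (0 < (F.L : ℝ))] [Fact (0 < ((F.L : ℝ)⁻¹) ^ (K - n))]
    {ε₀ e : ℝ} (hε₀ : 0 < ε₀) (he : 0 < e) (hWe : 10 ^ 9 * (F.L : ℝ) ^ 2 * e ≤ 1) (hWε : 10 ^ 12 * (F.L : ℝ) ^ 3 * ε₀ ≤ 1) (hreg : RegPr F n K ε₀ U₀) :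
    ∀ B : PBond (F.P n) 0 → Matrix (Fin 2) (Fin 2) ℂ, (∀ c, (B c).IsHermitian ∧ (B c).trace = 0) →
      ∀ x : Bond 3 (periodsT3 F K), (JetSup.equiv _ _ _ (H1f F n K h c₀ cB a (DeltaOne F n K h c₀ cB a (fun _ => 0)) U₀ B) x).IsHermitian ∧
        (JetSup.equiv _ _ _ (H1f F n K h c₀ cB a (DeltaOne F n K h c₀ cB a (fun _ => 0)) U₀ B) x).trace = 0 :=
  H1f_isHermitian_traceless_at_regPr_DeltaOne F n K h c₀ cB a (fun _ => 0) U₀ hε₀ he hWe hWε hreg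
    (fun f => by rw [LinearMap.zero_apply, LinearMap.zero_apply, map_zero, star_zero, map_zero])
    (fun A _ b => by rw [LinearMap.zero_apply, map_zero, Pi.zero_apply, Matrix.trace_zero])
    (fun x y => by rw [LinearMap.zero_apply, LinearMap.zero_apply, inner_zero_left, inner_zero_right])

/-- … and THE SAME READ AT THE `Δ_π` SLOT `DeltaPiSlot` (today's EX-junction slot, ✓`Prop7SectET3EXJunctionRowsT3`), by ✓`DeltaOne_zero`. [cite: Balaban1985BackgroundPropagators, (3.119) p.419, (3.126) p.420] -/
theorem H1f_isHermitian_traceless_at_regPr_DeltaPiSlot [Fact (0 < (F.L : ℝ))] [Fact (0 < ((F.L : ℝ)⁻¹) ^ (K - n))]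
    {ε₀ e : ℝ} (hε₀ : 0 < ε₀) (he : 0 < e) (hWe : 10 ^ 9 * (F.L : ℝ) ^ 2 * e ≤ 1) (hWε : 10 ^ 12 * (F.L : ℝ) ^ 3 * ε₀ ≤ 1) (hreg : RegPr F n K ε₀ U₀) :
    ∀ B : PBond (F.P n) 0 → Matrix (Fin 2) (Fin 2) ℂ, (∀ c, (B c).IsHermitian ∧ (B c).trace = 0) →
      ∀ x : Bond 3 (periodsT3 F K), (JetSup.equiv _ _ _ (H1f F n K h c₀ cB a (DeltaPiSlot F n K h c₀ cB a) U₀ B) x).IsHermitian ∧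
        (JetSup.equiv _ _ _ (H1f F n K h c₀ cB a (DeltaPiSlot F n K h c₀ cB a) U₀ B) x).trace = 0 := by
  rw [← DeltaOne_zero]
  exact H1f_isHermitian_traceless_at_regPr_DeltaOne_zero F n K h c₀ cB a U₀ hε₀ he hWe hWε hreg

end Summit.QuantumFields.YangMills.Theorems.Prop7SectET3DeltaOne

end
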